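import Mathlib.Algebra.Order.BigOperators.Ring.Finset
import Mathlib.Algebra.BigOperators.Pi
import Mathlib.Data.Fintype.BigOperators
import Mathlib.Data.Real.Basic
import Mathlib.Tactic.Linarith
import Mathlib.Tactic.Positivity
import HarnessLib

/-!
# `UV3BranchExpansionCountingCover` — (F-C2)-cover of the hTop BRANCH (MÖBIUS) EXPANSION: THE PRODUCT–SUM COVERING INEQUALITIES OF EXPLORATION TREES
# (crux `UnitScaleTilt.HistoryTailL`, stmt-QuantumFields-19936 — SUPPLY side, record-independent finite combinatorics)

Cell `ym3-torus` (YM ladder rung R3 = continuum SU(2) Yang–Mills on T³ — a RUNG, NOT d = 4, NOT infinite volume, NOT a mass gap, NOT Clay);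
width seat `ym3-torus-px13` (gen 13), explicit-unit helper; `--supports stmt-QuantumFields-19936 --as helper`.  THEOREMS ONLY (0 `def`, 0 `sorry`,
default heartbeats, Mathlib + HarnessLib imports only).

WHAT.  LEAD ★w1-19936 g12's note `Cruxes/HistoryTailL/HTopBranchExpansion.md` §5 (C) counts the LIVE sets `𝐬` of the branch expansion by exploration trees:
every node of such a tree has a finite set of SLOTS (the top bonds of `PBond(K)` at the root; the `≤ r₀` read bonds under an element node; the crossing slot and the
`L − 1` side slots under a ghost bond), each slot is filled from a finite MENU of sub-patterns (empty ∕ a Dist-subtree ∕ one of `≤ ρ₀` element subtrees), the pattern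
of a node is the DISJOINT union of its own elements (its «core»: `{σ}` for an element node, `∅` for a bond node) and of the patterns in its slots, and the weight is
`x^{#elements}`.  THIS FILE proves the one generic inequality behind all three generating-function rows of §5 and behind the covering inequality
`Σ_{𝐬 live, 𝐬 ≠ ∅} x^{|𝐬|} ≤ (1 + D_K)^{#PBond(K)} − 1`:

* §1 `card_core_union_biUnion` ∕ `pow_card_core_union_biUnion` — the weight of a node pattern factorises over its slots: `x^{|c ∪ ⨆_b t_b|} = x^{|c|}·Π_b x^{|t_b|}`
  (core and slot patterns pairwise disjoint);
* §2 ★★★ `sum_pow_card_le_core_mul_prod` — if every pattern `s ∈ P` decomposes as `s = c ∪ ⨆_b f s b` with `f s b` in the menu `M b`, then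
  `Σ_{s ∈ P} x^{|s|} ≤ x^{|c|} · Π_b (Σ_{t ∈ M b} x^{|t|})` (`x ≥ 0`; the decomposition is automatically injective, `Finset.sum_image` + `Finset.prod_univ_sum`);
  ★★ `sum_pow_card_le_prod_sub_one` — the same with empty core, non-empty patterns and `∅` in every menu: `≤ Π_b (Σ_{t ∈ M b} x^{|t|}) − 1` (the all-empty filling is
  in the product but is the image of no pattern);
* §3 the three rows of §5 (C) as corollaries with the slot sums AS HYPOTHESES: ★ `cover_le_pow_sub_one` (`Σ_{live ≠ ∅} x^{|𝐬|} ≤ (1 + D)^N − 1`, root: `N` top-bond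
  slots each with menu sum `≤ 1 + D`), ★ `elementNode_le` (`E ≤ x·(1 + D)^{r₀}`: core `{σ}`, at most `r₀` slots with menu sum `≤ 1 + D`), ★ `ghostNode_le`
  (`≤ D·(D + ρ₀E)^{L−1}`-shape: one distinguished slot with menu sum `≤ A`, the other `m` slots with menu sum `≤ B`, `Π ≤ A·B^{m}`).

HONEST SCOPE.  Finite combinatorics of a displayed decomposition; the model-specific letters (which bonds are slots, the menus, that the first-discovery tree of a
live set IS such a decomposition — LEAD's (M′)∕(F-C1)) are NOT here.  Nothing of hTop, the χ (α) record `AlphaInputsT3ACv4RecChi`, (O‴χₛ), `HistoryTailL`, the rung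
R3 is proved; the Yang–Mills mass gap is NOT proved.

References: T. Bałaban, CMP **102** (1985) 255–275 [Balaban1985UV3] ((47), (55) pp.268–270); LEAD note `Cruxes/HistoryTailL/HTopBranchExpansion.md` §5 (C), §6 (F-C2).
-/

set_option autoImplicit false

open Finset

namespace Summit.QuantumFields.YangMills.Theorems.UV3BranchExpansionCountingCover

variable {ι β : Type*} [DecidableEq ι] [Fintype β]

/-! ## §1 The weight of a node pattern factorises over its slots -/

/-- **CARDINALITY OF A NODE PATTERN**: a core `c` and pairwise disjoint slot patterns `g b`, all disjoint from the core, have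
`|c ∪ ⋃_b g b| = |c| + Σ_b |g b|`. [folklore] -/
theorem card_core_union_biUnion (c : Finset ι) (g : β → Finset ι)
    (hdisj : ∀ b₁ b₂, b₁ ≠ b₂ → Disjoint (g b₁) (g b₂)) (hc : ∀ b, Disjoint c (g b)) :
    (c ∪ Finset.univ.biUnion g).card = c.card + ∑ b, (g b).card := by
  have hpd : (↑(Finset.univ : Finset β) : Set β).PairwiseDisjoint g := fun b₁ _ b₂ _ h => hdisj b₁ b₂ h
  rw [Finset.card_union_of_disjoint ((Finset.disjoint_biUnion_right _ _ _).mpr fun b _ => hc b),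
    Finset.card_biUnion hpd]

/-- **THE WEIGHT FACTORISES**: `x^{|c ∪ ⋃_b g b|} = x^{|c|} · Π_b x^{|g b|}` for a core and pairwise disjoint slot patterns disjoint from it. [folklore] -/
theorem pow_card_core_union_biUnion (c : Finset ι) (g : β → Finset ι)
    (hdisj : ∀ b₁ b₂, b₁ ≠ b₂ → Disjoint (g b₁) (g b₂)) (hc : ∀ b, Disjoint c (g b)) (x : ℝ) :
    x ^ (c ∪ Finset.univ.biUnion g).card = x ^ c.card * ∏ b, x ^ (g b).card := by
  rw [card_core_union_biUnion c g hdisj hc, pow_add, Finset.prod_pow_eq_pow_sum]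

/-! ## §2 The product–sum inequality of one node -/

/-- **A SLOT DECOMPOSITION IS INJECTIVE**: if every `s ∈ P` is recovered from its slot filling, `s = c ∪ ⋃_b f s b`, then `f` is injective on `P`. [folklore] -/
theorem injOn_of_decomp (P : Finset (Finset ι)) (c : Finset ι) (f : Finset ι → β → Finset ι)
    (hcov : ∀ s ∈ P, s = c ∪ Finset.univ.biUnion (f s)) : Set.InjOn f P := by
  intro s₁ h₁ s₂ h₂ heq
  rw [hcov s₁ h₁, hcov s₂ h₂, heq]

/-- ★★★ **THE PRODUCT–SUM INEQUALITY OF ONE NODE**: let `P` be a finite set of patterns, `c` a core, `M b` a finite menu for each slot `b` of a finite slot type, and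
`f` a slot filling with `f s b ∈ M b`, the `f s b` pairwise disjoint and disjoint from `c`, and `s = c ∪ ⋃_b f s b` for every `s ∈ P`.  Then for `x ≥ 0`
`Σ_{s ∈ P} x^{|s|} ≤ x^{|c|} · Π_b (Σ_{t ∈ M b} x^{|t|})` — the generating function of the node is at most its own weight times the product of the slot generating
functions (over-counting by fillings that are the image of no pattern only helps). [folklore] -/
theorem sum_pow_card_le_core_mul_prod (P : Finset (Finset ι)) (M : β → Finset (Finset ι)) (c : Finset ι)
    (f : Finset ι → β → Finset ι)
    (hM : ∀ s ∈ P, ∀ b, f s b ∈ M b)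
    (hdisj : ∀ s ∈ P, ∀ b₁ b₂, b₁ ≠ b₂ → Disjoint (f s b₁) (f s b₂))
    (hc : ∀ s ∈ P, ∀ b, Disjoint c (f s b))
    (hcov : ∀ s ∈ P, s = c ∪ Finset.univ.biUnion (f s))
    {x : ℝ} (hx : 0 ≤ x) :
    ∑ s ∈ P, x ^ s.card ≤ x ^ c.card * ∏ b, ∑ t ∈ M b, x ^ t.card := by
  classical
  have hinj : Set.InjOn f P := injOn_of_decomp P c f hcov
  have hw : ∀ s ∈ P, x ^ s.card = x ^ c.card * ∏ b, x ^ (f s b).card := fun s hs => by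
    conv_lhs => rw [hcov s hs]
    exact pow_card_core_union_biUnion c (f s) (hdisj s hs) (hc s hs) x
  have hsub : P.image f ⊆ Fintype.piFinset M := by
    intro g hg
    obtain ⟨s, hs, rfl⟩ := Finset.mem_image.mp hg
    exact Fintype.mem_piFinset.mpr (hM s hs)
  calc ∑ s ∈ P, x ^ s.card = ∑ s ∈ P, x ^ c.card * ∏ b, x ^ (f s b).card := Finset.sum_congr rfl hw
    _ = x ^ c.card * ∑ s ∈ P, ∏ b, x ^ (f s b).card := by rw [Finset.mul_sum]
    _ = x ^ c.card * ∑ g ∈ P.image f, ∏ b, x ^ (g b).card := by rw [Finset.sum_image hinj]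
    _ ≤ x ^ c.card * ∑ g ∈ Fintype.piFinset M, ∏ b, x ^ (g b).card := by
        refine mul_le_mul_of_nonneg_left ?_ (pow_nonneg hx _)
        exact Finset.sum_le_sum_of_subset_of_nonneg hsub fun g _ _ => Finset.prod_nonneg fun b _ => pow_nonneg hx _
    _ = x ^ c.card * ∏ b, ∑ t ∈ M b, x ^ t.card := by rw [Finset.prod_univ_sum]

/-- ★★ **THE PRODUCT–SUM INEQUALITY, EMPTY CORE, NON-EMPTY PATTERNS**: if moreover the core is empty, every pattern of `P` is non-empty and the empty pattern is on
every menu, the all-empty filling lies in the product but is the image of no pattern, so `Σ_{s ∈ P} x^{|s|} ≤ Π_b (Σ_{t ∈ M b} x^{|t|}) − 1`. [folklore] -/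
theorem sum_pow_card_le_prod_sub_one (P : Finset (Finset ι)) (M : β → Finset (Finset ι)) (f : Finset ι → β → Finset ι)
    (hM : ∀ s ∈ P, ∀ b, f s b ∈ M b)
    (hdisj : ∀ s ∈ P, ∀ b₁ b₂, b₁ ≠ b₂ → Disjoint (f s b₁) (f s b₂))
    (hcov : ∀ s ∈ P, s = Finset.univ.biUnion (f s))
    (hne : ∀ s ∈ P, s.Nonempty) (hempty : ∀ b, (∅ : Finset ι) ∈ M b)
    {x : ℝ} (hx : 0 ≤ x) :
    ∑ s ∈ P, x ^ s.card ≤ (∏ b, ∑ t ∈ M b, x ^ t.card) - 1 := by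
  classical
  have hcov' : ∀ s ∈ P, s = ∅ ∪ Finset.univ.biUnion (f s) := fun s hs => by rw [Finset.empty_union]; exact hcov s hs
  have hinj : Set.InjOn f P := injOn_of_decomp P ∅ f hcov'
  have hw : ∀ s ∈ P, x ^ s.card = ∏ b, x ^ (f s b).card := fun s hs => by
    have h := pow_card_core_union_biUnion ∅ (f s) (hdisj s hs) (fun b => Finset.disjoint_empty_left _) x
    rwa [Finset.card_empty, pow_zero, one_mul, ← hcov' s hs] at h
  -- the all-empty filling
  set g₀ : β → Finset ι := fun _ => ∅ with hg₀
  have hg₀mem : g₀ ∈ Fintype.piFinset M := Fintype.mem_piFinset.mpr fun b => hempty b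
  have hg₀not : g₀ ∉ P.image f := by
    intro hg
    obtain ⟨s, hs, hfs⟩ := Finset.mem_image.mp hg
    have hs0 : s = ∅ := by
      rw [hcov s hs, hfs]
      ext i
      simp [hg₀]
    exact (hne s hs).ne_empty hs0
  have hsub : P.image f ⊆ (Fintype.piFinset M).erase g₀ := by
    intro g hg
    refine Finset.mem_erase.mpr ⟨fun h => hg₀not (h ▸ hg), ?_⟩
    obtain ⟨s, hs, rfl⟩ := Finset.mem_image.mp hg
    exact Fintype.mem_piFinset.mpr (hM s hs)
  have hprod0 : ∏ b, x ^ (g₀ b).card = 1 := by simp [hg₀]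
  calc ∑ s ∈ P, x ^ s.card = ∑ s ∈ P, ∏ b, x ^ (f s b).card := Finset.sum_congr rfl hw
    _ = ∑ g ∈ P.image f, ∏ b, x ^ (g b).card := by rw [Finset.sum_image hinj]
    _ ≤ ∑ g ∈ (Fintype.piFinset M).erase g₀, ∏ b, x ^ (g b).card :=
        Finset.sum_le_sum_of_subset_of_nonneg hsub fun g _ _ => Finset.prod_nonneg fun b _ => pow_nonneg hx _
    _ = (∑ g ∈ Fintype.piFinset M, ∏ b, x ^ (g b).card) - ∏ b, x ^ (g₀ b).card := Finset.sum_erase_eq_sub hg₀mem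
    _ = (∏ b, ∑ t ∈ M b, x ^ t.card) - 1 := by rw [Finset.prod_univ_sum, hprod0]

/-! ## §3 The three rows of §5 (C), slot sums as hypotheses -/

/-- A product of `N` non-negative slot sums each `≤ S` is `≤ S^N`. [folklore] -/
theorem prod_le_pow_card (g : β → ℝ) {S : ℝ} (h0 : ∀ b, 0 ≤ g b) (hle : ∀ b, g b ≤ S) :
    ∏ b, g b ≤ S ^ Fintype.card β := by
  calc ∏ b, g b ≤ ∏ _b : β, S := Finset.prod_le_prod (fun b _ => h0 b) fun b _ => hle b
    _ = S ^ Fintype.card β := by rw [Finset.prod_const, Finset.card_univ]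

/-- ★ **THE COVERING INEQUALITY** `Σ_{𝐬 live, 𝐬 ≠ ∅} x^{|𝐬|} ≤ (1 + D)^N − 1`: at the root the slots are the `N = #PBond(K)` top bonds, every menu contains `∅` and has
`Σ_{t ∈ M b} x^{|t|} ≤ 1 + D` (`D` the top Dist-subtree generating function), every live `𝐬 ≠ ∅` is the disjoint union of its slot patterns. [folklore] -/
theorem cover_le_pow_sub_one (P : Finset (Finset ι)) (M : β → Finset (Finset ι)) (f : Finset ι → β → Finset ι)
    (hM : ∀ s ∈ P, ∀ b, f s b ∈ M b)
    (hdisj : ∀ s ∈ P, ∀ b₁ b₂, b₁ ≠ b₂ → Disjoint (f s b₁) (f s b₂))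
    (hcov : ∀ s ∈ P, s = Finset.univ.biUnion (f s))
    (hne : ∀ s ∈ P, s.Nonempty) (hempty : ∀ b, (∅ : Finset ι) ∈ M b)
    {x D : ℝ} (hx : 0 ≤ x) (hS : ∀ b, ∑ t ∈ M b, x ^ t.card ≤ 1 + D) :
    ∑ s ∈ P, x ^ s.card ≤ (1 + D) ^ Fintype.card β - 1 := by
  have h := sum_pow_card_le_prod_sub_one P M f hM hdisj hcov hne hempty hx
  have hp : ∏ b, ∑ t ∈ M b, x ^ t.card ≤ (1 + D) ^ Fintype.card β :=
    prod_le_pow_card _ (fun b => Finset.sum_nonneg fun t _ => pow_nonneg hx _) hS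
  linarith

/-- ★ **THE ELEMENT-NODE ROW** `E ≤ x·(1 + D)^{r₀}`: an element node has core `{σ}` (weight `x`) and at most `r₀` slots (its read bonds), each with a menu containing the
empty pattern or a Dist-subtree, menu sum `≤ 1 + D`. [folklore] -/
theorem elementNode_le (P : Finset (Finset ι)) (M : β → Finset (Finset ι)) (σ : ι) (f : Finset ι → β → Finset ι)
    (hM : ∀ s ∈ P, ∀ b, f s b ∈ M b)
    (hdisj : ∀ s ∈ P, ∀ b₁ b₂, b₁ ≠ b₂ → Disjoint (f s b₁) (f s b₂))
    (hc : ∀ s ∈ P, ∀ b, σ ∉ f s b)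
    (hcov : ∀ s ∈ P, s = insert σ (Finset.univ.biUnion (f s)))
    {x D : ℝ} (hx : 0 ≤ x) (hD : 0 ≤ D) (hS : ∀ b, ∑ t ∈ M b, x ^ t.card ≤ 1 + D) {r₀ : ℕ} (hr : Fintype.card β ≤ r₀) :
    ∑ s ∈ P, x ^ s.card ≤ x * (1 + D) ^ r₀ := by
  have hcov' : ∀ s ∈ P, s = {σ} ∪ Finset.univ.biUnion (f s) := fun s hs =>
    (hcov s hs).trans (Finset.insert_eq σ _)
  have hc' : ∀ s ∈ P, ∀ b, Disjoint ({σ} : Finset ι) (f s b) := fun s hs b =>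
    Finset.disjoint_singleton_left.mpr (hc s hs b)
  have h := sum_pow_card_le_core_mul_prod P M {σ} f hM hdisj hc' hcov' hx
  rw [Finset.card_singleton, pow_one] at h
  have hp : ∏ b, ∑ t ∈ M b, x ^ t.card ≤ (1 + D) ^ Fintype.card β :=
    prod_le_pow_card _ (fun b => Finset.sum_nonneg fun t _ => pow_nonneg hx _) hS
  have hmono : (1 + D) ^ Fintype.card β ≤ (1 + D) ^ r₀ := pow_le_pow_right₀ (by linarith) hr
  exact h.trans (mul_le_mul_of_nonneg_left (hp.trans hmono) hx)

/-- **ONE DISTINGUISHED SLOT**: non-negative slot sums with `g b₀ ≤ A` and `g b ≤ B` for `b ≠ b₀` have `Π_b g b ≤ A·B^{N−1}` (`N` the number of slots). [folklore] -/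
theorem prod_le_mul_pow_of_distinguished [DecidableEq β] (g : β → ℝ) (b₀ : β) {A B : ℝ} (h0 : ∀ b, 0 ≤ g b)
    (hA : g b₀ ≤ A) (hB : ∀ b, b ≠ b₀ → g b ≤ B) :
    ∏ b, g b ≤ A * B ^ (Fintype.card β - 1) := by
  have hsplit : ∏ b, g b = g b₀ * ∏ b ∈ Finset.univ.erase b₀, g b :=
    (Finset.mul_prod_erase Finset.univ g (Finset.mem_univ b₀)).symm
  have hrest : ∏ b ∈ Finset.univ.erase b₀, g b ≤ B ^ (Fintype.card β - 1) := by
    calc ∏ b ∈ Finset.univ.erase b₀, g b ≤ ∏ _b ∈ Finset.univ.erase b₀, B :=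
          Finset.prod_le_prod (fun b _ => h0 b) fun b hb => hB b (Finset.ne_of_mem_erase hb)
      _ = B ^ (Fintype.card β - 1) := by rw [Finset.prod_const, Finset.card_erase_of_mem (Finset.mem_univ b₀), Finset.card_univ]
  have hA0 : 0 ≤ A := (h0 b₀).trans hA
  rw [hsplit]
  exact mul_le_mul hA hrest (Finset.prod_nonneg fun b _ => h0 b) hA0

/-- ★ **THE GHOST-NODE ROW** `≤ D·(D + ρ₀E)^{L−1}`-shape: a ghost bond node has empty core, a distinguished slot (its crossing bond, menu = Dist-subtrees only, sum `≤ A`)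
and the other slots (its `L − 1` side bonds, menu = empty ∕ Dist-subtree ∕ one of `≤ ρ₀` element subtrees, sum `≤ B`); then its generating function is
`≤ A·B^{N−1}` (`N` = number of slots; read with `A = D_i`, `B = D_i + ρ₀E_i` — or `1 + D_i + ρ₀E_i` if empty side slots are allowed — and `N = L`). [folklore] -/
theorem ghostNode_le [DecidableEq β] (P : Finset (Finset ι)) (M : β → Finset (Finset ι)) (f : Finset ι → β → Finset ι) (b₀ : β)
    (hM : ∀ s ∈ P, ∀ b, f s b ∈ M b)
    (hdisj : ∀ s ∈ P, ∀ b₁ b₂, b₁ ≠ b₂ → Disjoint (f s b₁) (f s b₂))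
    (hcov : ∀ s ∈ P, s = Finset.univ.biUnion (f s))
    {x A B : ℝ} (hx : 0 ≤ x) (hA : ∑ t ∈ M b₀, x ^ t.card ≤ A) (hB : ∀ b, b ≠ b₀ → ∑ t ∈ M b, x ^ t.card ≤ B) :
    ∑ s ∈ P, x ^ s.card ≤ A * B ^ (Fintype.card β - 1) := by
  have hcov' : ∀ s ∈ P, s = ∅ ∪ Finset.univ.biUnion (f s) := fun s hs => by rw [Finset.empty_union]; exact hcov s hs
  have h := sum_pow_card_le_core_mul_prod P M ∅ f hM hdisj (fun s _ b => Finset.disjoint_empty_left _) hcov' hx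
  rw [Finset.card_empty, pow_zero, one_mul] at h
  exact h.trans (prod_le_mul_pow_of_distinguished _ b₀ (fun b => Finset.sum_nonneg fun t _ => pow_nonneg hx _) hA hB)

end Summit.QuantumFields.YangMills.Theorems.UV3BranchExpansionCountingCover
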